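import Literature.AlgebraicGeometry.HodgeTheory.GysinFormalism
import Literature.AlgebraicGeometry.HodgeTheory.RationalHodgeClasses
import HarnessLib

/-!
# Weights kill the restriction of a class of a smooth projective variety lying in the span of cup products with classes of units

Topic `Literature/AlgebraicGeometry/HodgeTheory`. One NAMED FACT (D-0014),
`deligne1971_weightKill_cupUnits`, recording the following consequence of Deligne's mixed Hodge
theory. Let `X` be a smooth projective complex variety, `W` a smooth complex algebraic variety
(a smooth separated `ℂ`-scheme of finite type), `j : W → X` a morphism, `d ≥ 0`, and
`x ∈ H^{d+1}(X(ℂ); ℚ)`. For global units `u₁, …, u_r ∈ Γ(W, 𝒪_W)ˣ = Hom(W, 𝔾_m)` let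
`eᵢ = uᵢ^* ξ ∈ H¹(W(ℂ); ℚ)` be the pull-backs of the generator `ξ = [dz / 2πiz]` of
`H¹(𝔾_m(ℂ); ℚ) = H¹(ℂ ∖ 0; ℚ)`. If `j^* x = Σᵢ bᵢ ∪ eᵢ` with `bᵢ ∈ H^d(W(ℂ); ℚ)`, then `j^* x = 0`;
the same holds with complex coefficients (`b ∈ H^d(W(ℂ); ℂ)`, `γ ∈ H¹(ℂ ∖ 0; ℂ)`, `x` rational).

Printed proof. (1) The rational cohomology of every complex algebraic variety carries a functorial
mixed Hodge structure (Hodge II Thm. 3.2.5 for smooth varieties, Hodge III §8.2 in general; held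
restatements: Dimca, App. C Thm. (C24); Cattani–El Zein–Griffiths–Lê, Def. 3.4.23), with:
`H^k(X)` pure of weight `k` for `X` smooth projective (Dimca (C25) (ii)); `W_{k-1} H^k(W) = 0` for
`W` smooth — the weights of `H^k(W)` are `≥ k` (Hodge II Cor. 3.2.15; Dimca (C24) (iii));
`W_k H^k(W) = Im H^k(W̄)` for a smooth compactification (Hodge II Cor. 3.2.17), whence
`H¹(𝔾_m) = H¹(ℙ¹ ∖ {0, ∞})` is one-dimensional of weight `2` and Hodge type `(1, 1)` (spanned by
the logarithmic form `dz/z`), i.e. `H¹(𝔾_m) ≅ ℚ(-1)`. (2) Cup products are morphisms of mixed Hodge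
structures `H^a(W) ⊗ H^b(W) → H^{a+b}(W)` (Hodge III §8.2, Künneth; Cattani et al. §3.4.2.12
Problem (2) (iii)), and `ℚ(-1) → H¹(W)`, `1 ↦ eᵢ = uᵢ^* ξ`, is a morphism (functoriality for the
morphism `uᵢ : W → 𝔾_m`); hence `F : ⊕ᵢ H^d(W)(-1) → H^{d+1}(W)`, `(bᵢ) ↦ Σ bᵢ ∪ eᵢ`, is a morphism
of mixed Hodge structures whose source `H^d(W) ⊗ ℚ(-1)` has weights `≥ d + 2`, i.e.
`W_{d+1}(source) = W_{d-1} H^d(W) ⊗ ℚ(-1) = 0`. (3) Morphisms of mixed Hodge structures are strict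
for `W` (Hodge II Thm. 2.3.5 (iii); Dimca (C22); Cattani et al. Cor. 3.2.21):
`Im F ∩ W_{d+1} H^{d+1}(W) = F(W_{d+1}(source)) = 0`. (4) `j^*` is a morphism of mixed Hodge
structures and `H^{d+1}(X) = W_{d+1} H^{d+1}(X)`, so `j^* x ∈ W_{d+1} H^{d+1}(W) ∩ Im F = 0`. With
complex coefficients: `H^*(W(ℂ); ℂ) = H^*(W(ℂ); ℚ) ⊗ ℂ` (`W(ℂ)` has the homotopy type of a finite
CW complex), the `ℂ`-span of the classes `b ∪ u(ℂ)^* γ` is `(Σ_u Im F_u) ⊗ ℂ` for finitely many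
units `u`, and `(V ⊗ ℂ) ∩ (W_{d+1} ⊗ ℂ) = (V ∩ W_{d+1}) ⊗ ℂ = 0`.
Sharpness: FALSE with arbitrary classes `e ∈ H¹(W(ℂ); ℚ)` in place of classes of units (on an
elliptic curve `W = X = E`, `j = 𝟙`, `d = 1`, the fundamental class is `b ∪ e` with
`b, e ∈ H¹(E)` of weight `1`): the point is that classes of UNITS have weight `2`; and the
smoothness of `W` enters through `W_{k-1} H^k(W) = 0`, which fails for singular `W`.

Vocabulary (nothing is redefined): the tree's `complexBetti`, `complexBetti.map`, `cupProduct`,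
`IsRationalClass`, `Motives.IsSmoothProjective`; a global unit `u ∈ Γ(W, 𝒪_W)` is evaluated at
complex points by `Motives.AlgPoints.evalOrZero ⊤ u` (a continuous nowhere-vanishing function
`W(ℂ) → ℂ`, the map on complex points of `u : W → 𝔾_m` followed by `𝔾_m(ℂ) = ℂ ∖ 0`), and the
class `eᵢ` is the pull-back of a class of `H¹(ℂ ∖ 0; ℂ)` along that continuous map
`υ : C(W(ℂ), ℂ ∖ 0)`. Consumer: the line `NashDescentSketch` of the crux `SymbolClassesAlgebraic`
(route `MilnorKExponential` of `HodgeConjecture`), support file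
`Theorems/MilnorKExponentialSymbolClassesAlgebraicNashWeightTwoBand.lean` of that summit (step (W):
the globalised Nash symbol class is a combination of cups with `dlog` classes of units on a finite
étale cover of a Zariski-dense subset, hence dies there). Not here: mixed Hodge
structures on non-complete varieties, Tate twists, tensor products and the Künneth compatibility
(the tree's `Motives.MixedHodgeStructureOfPair` has neither weight bounds for smooth non-complete
varieties nor cup products; its inhabitant `Motives.MixedHodgeStructureOfPair.existsDeligne` is
itself a named fact).

## References

* [DeligneHodgeII1971] P. Deligne, Théorie de Hodge II, Publ. Math. IHÉS 40 (1971), Thm. 2.3.5,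
  Thm. 3.2.5, Cor. 3.2.15, Cor. 3.2.17.
* [DeligneHodgeIII1974] P. Deligne, Théorie de Hodge III, Publ. Math. IHÉS 44 (1974), §8.2.
* [Dimca1992] A. Dimca, Singularities and Topology of Hypersurfaces (1992), Appendix C, (C20)–(C25).
* [CattaniElZeinGriffithsLe2014] E. Cattani, F. El Zein, P. Griffiths, Lê D. T. (eds.), Hodge Theory
  (2014), Cor. 3.2.21, Def. 3.4.23, §3.4.2.12 Problem (2).
* [PetersSteenbrink2008] C. Peters, J. Steenbrink, Mixed Hodge Structures (2008), Part II.
-/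

noncomputable section

open CategoryTheory AlgebraicGeometry
open Literature.AlgebraicTopology.SingularHomology

namespace Literature.AlgebraicGeometry.HodgeTheory

section HodgeTheory

/-- **Weights kill the restriction of a class of a smooth projective variety that becomes a
combination of cup products with classes of global units** (named fact; Deligne). Let `X` be a
smooth projective complex variety, `W` a smooth complex algebraic variety (a smooth separated
`ℂ`-scheme of finite type), `j : W → X` a morphism and `x ∈ H^{d+1}(X(ℂ); ℚ)`. The rational
cohomology of every complex algebraic variety carries a functorial mixed Hodge structure (Hodge II
Thm. 3.2.5 for smooth varieties, Hodge III §8.2 in general; Dimca (C24); Cattani et al.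
Def. 3.4.23) such that: `H^k(X)` is pure of weight `k` for `X` smooth projective;
`W_{k-1} H^k(W) = 0` for `W` smooth, i.e. the weights of `H^k(W)` are `≥ k` (Hodge II Cor. 3.2.15;
Dimca (C24) (iii)); `H¹(𝔾_m) = H¹(ℙ¹ ∖ {0, ∞})` is of weight `2` (`W₁ H¹ = Im H¹(ℙ¹) = 0`,
Hodge II Cor. 3.2.17), so the class `u^*[dz/z] ∈ H¹(W)` of a unit
`u ∈ Γ(W, 𝒪_W)ˣ = Hom(W, 𝔾_m)` spans a copy of `ℚ(-1)`; cup products (Künneth) are morphisms of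
mixed Hodge structures (Hodge III §8.2; Cattani et al. §3.4.2.12 Problem (2)); and morphisms are
strict for the weight filtration (Hodge II Thm. 2.3.5 (iii); Dimca (C22); Cattani et al.
Cor. 3.2.21). Consequently, for units `u₁, …, u_r` of `W` the map
`(bᵢ)ᵢ ↦ Σᵢ bᵢ ∪ uᵢ^*[dz/z]`, `⊕ᵢ H^d(W)(-1) → H^{d+1}(W)`, is a morphism of mixed Hodge structures
whose source has weights `≥ d + 2`, so its image meets `W_{d+1} H^{d+1}(W) ⊇ j^* H^{d+1}(X)` only
in `0` (and the same holds after `⊗ ℂ`). Statement (complex coefficients, the tree's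
`complexBetti`, `cupProduct`; units evaluated at complex points by `AlgPoints.evalOrZero ⊤ u`;
the class of `𝔾_m(ℂ) = ℂ ∖ 0` pulled back along the continuous map `u(ℂ) : W(ℂ) → ℂ ∖ 0`): if
`j^* x` lies in the `ℂ`-span of the classes `b ∪ u(ℂ)^* γ`, `b ∈ H^d(W(ℂ); ℂ)`, `u` a global
unit of `W`, `γ ∈ H¹(ℂ ∖ 0; ℂ)`, then `j^* x = 0`.
[cite: DeligneHodgeII1971, Thm. 2.3.5 (iii), Thm. 3.2.5 (iii), Cor. 3.2.15 and Cor. 3.2.17]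
[cite: DeligneHodgeIII1974, §8.2 (functoriality; Künneth formula and cup products)]
[cite: Dimca1992, Appendix C, Prop. (C22) and Thm. (C24)]
[cite: CattaniElZeinGriffithsLe2014, Cor. 3.2.21, Def. 3.4.23 and §3.4.2.12 Problem (2)] -/
def deligne1971_weightKill_cupUnits : Prop :=
  ∀ ⦃n : ℕ⦄ ⦃X : Motives.SchemeOver ℂ⦄, Motives.IsSmoothProjective n X →
    ∀ ⦃m : ℕ⦄ ⦃W : Motives.SchemeOver ℂ⦄ [IsSeparated W.hom] [QuasiCompact W.hom],
      SmoothOfRelativeDimension m W.hom →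
      ∀ (j : W ⟶ X) (d : ℕ) (x : complexBetti X (d + 1)), IsRationalClass x →
        complexBetti.map j (d + 1) x ∈ Submodule.span ℂ
          {y : complexBetti W (d + 1) |
            ∃ (b : complexBetti W d) (e : complexBetti W 1),
              (∃ (u : Γ(W.left, ⊤)) (υ : C(Motives.ComplexPoints W, {z : ℂ // z ≠ 0}))
                  (γ : singularCohomology ℂ ℂ {z : ℂ // z ≠ 0} 1),
                IsUnit u ∧ (∀ P, (υ P : ℂ) = Motives.AlgPoints.evalOrZero ⊤ u P) ∧
                  e = singularCohomology.map ℂ ℂ υ 1 γ) ∧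
              y = cupProduct (rfl : d + 1 = d + 1) b e} →
        complexBetti.map j (d + 1) x = 0

-- TODO(general form): Deligne's theorem is the mixed Hodge structure itself (Hodge II 3.2.5,
-- III 8.2.1–8.2.4) with its weight bounds, Künneth compatibility and strictness, for every complex
-- algebraic variety and every morphism to 𝔾_m^r; stated here is the one consequence the consumer
-- needs (no Tate twists or tensor products of mixed Hodge structures exist in the tree to phrase
-- "cup product with the class of a unit is a morphism from the (-1)-twist").

end HodgeTheory

end Literature.AlgebraicGeometry.HodgeTheory

end
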